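import Summits.SmoothPoincare4.SmoothPoincare4.Theorems.ConvexBisectionAcyclicBisectionExistsBaseReflectionDeriv
import Summits.SmoothPoincare4.SmoothPoincare4.Theorems.ConvexBisectionAcyclicBisectionExistsBaseReflection
import Literature.Topology.PlaneTopology.AnnulusLogarithm
import Literature.Topology.PlaneTopology.JordanSweepParity
import Literature.Topology.FourManifolds.LefschetzBaseShadow
import HarnessLib

/-!
# The fibred orientation-reversing involution of the Lefschetz base, IV: it negates the page
# twisting of framed page curves
(wave 2, node "fibred orientation-reversing involution `σ` of `Base g`" of stub
`stub_steinRealisation` = NF6, line `modp-braid-orbits` r11, crux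
`ConvexBisection.AcyclicBisectionExists`, item stmt-SmoothPoincare4-10508; registered sub-goals
`helper_pageTwisting_baseReflection` (consumer form) and `helper_exists_fibredReflection`
(definition-free package of the four files))

Sequel of `…BaseReflectionMap/Deriv/….lean` and `…BaseReflection.lean`.  The page twisting
`pageTwisting g K ν = wind ℓ` of a framing `ν` of a loop `K` in a page of `Base g` is the winding
number of the twisting loop `ℓ = (⟪ν, iK'⟫, ⟪ν, n⟫)` (`LefschetzBasePages.lean` §6).  For the
reflected framed loop `(σ ∘ K, dσ(ν))` with twisting loop `ℓ̃`:

* §7 POINTWISE (`pageTwistingLoop_baseReflection_pointwise`): `ℓ̃₂ = ℓ₂` (`dσ` preserves `w`,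
  `dw` and `‖dΦ‖`, and `⟪·, n⟫ = Im(w̄ dΦ(·))/‖dΦ‖²`), and `ℓ̃₁ = -ℓ₁` wherever `ℓ₂ = 0` (there
  `Im(w̄ dΦ(ν)) = 0 = Re(w̄ dΦ(ν))` — the framing is tangent to `{rho = 1/4}` — so `ν` is a page
  tangent, `dσ = A` is antilinear and real-orthogonal on `ker dΦ ∋ ν, K'`, and
  `⟪Aν, iAK'⟫ = -⟪ν, iK'⟫`).  In general `ℓ̃₁ = -ℓ₁ + c(t) ℓ₂` for a continuous `c` coming from the
  vertical correction `u ⊗ f` of `dσ`; the two facts above are what the homotopy needs.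
  HOMOTOPY: `H_s = (1 − s) ℓ̃ + s (−conj ℓ)` never vanishes (`Im H_s = ℓ₂`; where `ℓ₂ = 0`,
  `Re H_s = -ℓ₁ ≠ 0` by `helper_pageTwistingLoop_ne_zero`), both loops are continuous
  (`continuous_pageTwistingLoop`: `C¹` loop + framing continuous into the tangent bundle; for the
  reflected one the framing is the tangent map of `σ` on the section `(K, ν)`), so
  `wind ℓ̃ = wind (−conj ℓ) = wind (conj ℓ) = −wind ℓ` (`wind_eq_of_homotopy`, `wind_neg`, `wind_conj`):
  **`pageTwisting g (σ ∘ K) (dσ ν) = -pageTwisting g K ν`** (`pageTwisting_baseReflection`,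
  `helper_pageTwisting_baseReflection`).
* §8 SHADOW ACTION (`exists_shadow_baseReflection_comp`): `shadow g (σ ∘ K) = S (shadow g K)` for a
  fixed `S : ℤ^{2g} ≃ₗ[ℤ] ℤ^{2g}` — the matrix of `σ_*` on `H₁(Base g; ℤ)` in the chain coordinates
  (`shadowMap g` is a bijection by `exists_isChainShadow_holds`, `LefschetzBaseShadow.lean`; naturality
  of the Hurewicz class `map_loopClass`).
* `helper_exists_fibredReflection`: the definition-free package — a self-diffeomorphism `σ` of
  `Base g` preserving `w`, `rho`, pages, boundary, involutive, restriction of a smooth `F` of `ℝ⁴`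
  with `det dF = -1` on the base and `ambient ∘ dσ = dF ∘ ambient`, negating page twistings.

Everything is proved; no named facts, no `sorry`.  References: J. B. Etnyre, T. Fuller, *Realizing
4-manifolds as achiral Lefschetz fibrations*, IMRN 2006, §2 [EtnyreFuller2006]; W. Fulton,
*Algebraic Topology: A First Course* (1995), §3 (homotopy invariance of winding numbers).
-/

noncomputable section

set_option linter.dupNamespace false

open scoped Manifold ContDiff Topology ComplexConjugate
open Set Function Metric Complex
open Literature.Topology.FourManifolds Literature.Topology.FourManifolds.LefschetzBase
open Literature.Geometry.Symplectic Literature.Topology.PlaneTopology Bundle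

namespace Summit.SmoothPoincare4.SmoothPoincare4.Theorems.AcyclicBisectionExists.ModpBraidOrbits

variable {g : ℕ}

/-! ## §7 The page twisting of a framed page curve is negated by `σ` -/

section Twisting

variable {K : sphere (0 : EuclideanSpace ℝ (Fin 2)) 1 → Base g}
  {ν : sphere (0 : EuclideanSpace ℝ (Fin 2)) 1 → EuclideanSpace ℝ (Fin 4)} {c : ℂ}

/-- **Pointwise comparison of the twisting loops**: the twisting loop `ℓ̃` of the reflected framed
loop `(σ ∘ K, dσ(ν))` and the twisting loop `ℓ` of `(K, ν)` have the same second component, and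
`ℓ̃₁ = -ℓ₁` wherever `ℓ₂ = 0` (there the framing vector is a page tangent and `dσ` is the
antilinear `A`). [folklore] -/
theorem pageTwistingLoop_baseReflection_pointwise (hc : ‖c‖ = 1)
    (hK : Manifold.IsSmoothEmbedding (𝓡 1) (𝓡∂ 4) ∞ K) (hpage : ∀ θ, K θ ∈ page g c)
    (hν : IsKnotFraming K ν) (t : ℝ) :
    (pageTwistingLoop g (baseReflection g ∘ K)
        (fun θ => mfderiv (𝓡∂ 4) (𝓡∂ 4) (baseReflection g) (K θ) (ν θ)) t).im =
      (pageTwistingLoop g K ν t).im ∧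
    ((pageTwistingLoop g K ν t).im = 0 →
      (pageTwistingLoop g (baseReflection g ∘ K)
        (fun θ => mfderiv (𝓡∂ 4) (𝓡∂ 4) (baseReflection g) (K θ) (ν θ)) t).re =
      -(pageTwistingLoop g K ν t).re) := by
  have hKd : MDifferentiableAt (𝓡 1) (𝓡∂ 4) K (circlePt t) := hK.contMDiff.mdifferentiableAt (by simp)
  have hreg : ambCurve g K t ∈ reflRegion g := mem_reflRegion_of_rho_le (K (circlePt t)).2
  -- the reflected loop, its velocity and its framing vector, read in `ℝ⁴`
  have e0 : ambCurve g (baseReflection g ∘ K) t = baseReflectionAmb g (ambCurve g K t) := rfl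
  have e1 := deriv_ambCurve_baseReflection_comp (g := g) hKd
  have e2 : ∀ θ, ambient g ((baseReflection g ∘ K) θ)
      (mfderiv (𝓡∂ 4) (𝓡∂ 4) (baseReflection g) (K θ) (ν θ)) =
      fderiv ℝ (baseReflectionAmb g) (K θ).1 (ambient g (K θ) (ν θ)) := fun θ =>
    ambient_mfderiv_baseReflection (K θ) (ν θ)
  refine ⟨?_, fun h0 => ?_⟩
  · show inner ℝ _ _ = inner ℝ _ _
    rw [e2, e0]
    exact inner_fderiv_baseReflectionAmb_horizNormal hreg _
  · -- `ℓ₂ = 0` forces `dΦ(V) = 0`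
    obtain ⟨hflat, hwc⟩ := hpage (circlePt t)
    have hw : w g (ambCurve g K t) ≠ 0 := by
      intro hz
      have e : w g (K (circlePt t)).1 = c / 2 := hwc
      rw [show w g (K (circlePt t)).1 = w g (ambCurve g K t) from rfl, hz] at e
      have : c = 0 := by linear_combination (-2) * e
      rw [this, norm_zero] at hc
      exact zero_ne_one hc
    have hbdry : rho g (ambCurve g K t) = 1 / 4 := rho_eq_of_mem_page g hc (hpage (circlePt t))
    have hre : (conj (w g (ambCurve g K t)) * (dPhiX g (ambCurve g K t) *
        cx (ambient g (K (circlePt t)) (ν (circlePt t))) + dPhiY (ambCurve g K t) *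
        cy (ambient g (K (circlePt t)) (ν (circlePt t))))).re = 0 := by
      have hflat' : ‖cx (ambCurve g K t)‖ ^ 2 < 4 := hflat
      have hV : fderiv ℝ (rho g) (ambCurve g K t) (ambient g (K (circlePt t)) (ν (circlePt t))) = 0 := by
        rw [show ambCurve g K t = (K (circlePt t)).1 from rfl, fderiv_rho_ambient _ hbdry,
          (mem_boundaryTangentSpace_iff _).1 (hν.mem_boundaryTangentSpace _), neg_zero]
      rw [fderiv_rho_apply_of_flat hflat'] at hV
      linarith
    have him : (conj (w g (ambCurve g K t)) * (dPhiX g (ambCurve g K t) *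
        cx (ambient g (K (circlePt t)) (ν (circlePt t))) + dPhiY (ambCurve g K t) *
        cy (ambient g (K (circlePt t)) (ν (circlePt t))))).im = 0 := by
      have h0' : inner ℝ (ambient g (K (circlePt t)) (ν (circlePt t))) (horizNormal g (ambCurve g K t)) = 0 := h0
      rw [inner_horizNormal, div_eq_zero_iff] at h0'
      exact h0'.resolve_right (normSq_dPhi_ne_zero (coe_ne_zero (K (circlePt t))))
    have hV0 : dPhiX g (ambCurve g K t) * cx (ambient g (K (circlePt t)) (ν (circlePt t))) +
        dPhiY (ambCurve g K t) * cy (ambient g (K (circlePt t)) (ν (circlePt t))) = 0 := by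
      have hprod : conj (w g (ambCurve g K t)) * (dPhiX g (ambCurve g K t) *
          cx (ambient g (K (circlePt t)) (ν (circlePt t))) + dPhiY (ambCurve g K t) *
          cy (ambient g (K (circlePt t)) (ν (circlePt t)))) = 0 :=
        Complex.ext (by rw [hre, Complex.zero_re]) (by rw [him, Complex.zero_im])
      exact (mul_eq_zero.1 hprod).resolve_left ((map_ne_zero _).2 hw)
    have hT0 := dPhi_velocity_eq_zero_of_page hpage (hasDerivAt_ambCurve (g := g) hKd).differentiableAt.hasDerivAt
    show inner ℝ _ _ = -inner ℝ _ _
    rw [e2, e1]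
    exact inner_fderiv_baseReflectionAmb_cplxJ hV0 hT0

/-- The ambient unit-period parametrisation of a `C¹` loop is `C¹`. [folklore] -/
theorem contDiff_ambCurve (hK : ContMDiff (𝓡 1) (𝓡∂ 4) 1 K) : ContDiff ℝ 1 (ambCurve g K) := by
  have h : ContMDiff 𝓘(ℝ, ℝ) (𝓡 4) 1 (ambCurve g K) :=
    ((RegularSublevel.contMDiff_incl (isRegularLevel_rho g)).of_le (by simp)).comp
      (hK.comp (contMDiff_circlePt.of_le (by simp)))
  exact contMDiff_iff_contDiff.1 h

/-- **The twisting loop of a continuous framing of a `C¹` loop is continuous.** [folklore] -/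
theorem continuous_pageTwistingLoop (hK : ContMDiff (𝓡 1) (𝓡∂ 4) 1 K)
    (hν : Continuous fun θ => (TotalSpace.mk' (EuclideanSpace ℝ (Fin 4)) (K θ) (ν θ) :
      TangentBundle (𝓡∂ 4) (Base g))) :
    Continuous (pageTwistingLoop g K ν) := by
  have hfam := continuousOn_pageTwistingLoop_family (g := g) (K := fun _ => K) (ν := fun _ => ν)
    (hK.continuous.comp continuous_snd).continuousOn
    (((continuous_ambient.comp hν).comp (continuous_circlePt.comp continuous_snd)).continuousOn)
    (continuousOn_deriv_of_contDiff_family (K := fun _ => K)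
      ((contDiff_ambCurve hK).comp contDiff_snd) _)
  exact hfam.comp_continuous (f := fun t : ℝ => ((0 : ℝ), t))
    (continuous_const.prodMk continuous_id) fun t => ⟨⟨le_rfl, zero_le_one⟩, mem_univ _⟩

/-- The reflected loop is `C¹` (indeed smooth). [folklore] -/
theorem contMDiff_baseReflection_comp (hK : ContMDiff (𝓡 1) (𝓡∂ 4) 1 K) :
    ContMDiff (𝓡 1) (𝓡∂ 4) 1 (baseReflection g ∘ K) :=
  ((baseReflection g).contMDiff.of_le (by simp)).comp hK

/-- The pushed framing `dσ(ν)` along `σ ∘ K` is continuous into the tangent bundle (it is the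
tangent map of `σ` on the section `(K, ν)`). [folklore] -/
theorem continuous_mfderiv_baseReflection_bundle
    (hν : Continuous fun θ => (TotalSpace.mk' (EuclideanSpace ℝ (Fin 4)) (K θ) (ν θ) :
      TangentBundle (𝓡∂ 4) (Base g))) :
    Continuous fun θ => (TotalSpace.mk' (EuclideanSpace ℝ (Fin 4)) ((baseReflection g ∘ K) θ)
      (mfderiv (𝓡∂ 4) (𝓡∂ 4) (baseReflection g) (K θ) (ν θ)) : TangentBundle (𝓡∂ 4) (Base g)) := by
  have key : (fun θ => (TotalSpace.mk' (EuclideanSpace ℝ (Fin 4)) ((baseReflection g ∘ K) θ)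
      (mfderiv (𝓡∂ 4) (𝓡∂ 4) (baseReflection g) (K θ) (ν θ)) : TangentBundle (𝓡∂ 4) (Base g))) =
      tangentMap (𝓡∂ 4) (𝓡∂ 4) (baseReflection g) ∘
        (fun θ => (TotalSpace.mk' (EuclideanSpace ℝ (Fin 4)) (K θ) (ν θ) :
          TangentBundle (𝓡∂ 4) (Base g))) := rfl
  rw [key]
  exact ((baseReflection g).contMDiff.continuous_tangentMap (by simp)).comp hν

/-- **The page twisting of a framed page curve is negated by the fibred reflection.**  For a
smooth embedding `K : 𝕊¹ → Base g` into the page `page g c` (`‖c‖ = 1`) with a framing `ν` in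
`∂ Base g` (`IsKnotFraming`), the reflected loop `σ ∘ K` (again in `page g c`) with the pushed
framing `dσ(ν)` has page twisting `-pageTwisting g K ν`: its twisting loop `ℓ̃` is homotopic through
non-vanishing loops (straight line) to the reflection `-conj ℓ` of the old one
(`pageTwistingLoop_baseReflection_pointwise`), and `wind (-conj ℓ) = -wind ℓ`. [folklore] -/
theorem pageTwisting_baseReflection (hc : ‖c‖ = 1) (hK : Manifold.IsSmoothEmbedding (𝓡 1) (𝓡∂ 4) ∞ K)
    (hpage : ∀ θ, K θ ∈ page g c) (hν : IsKnotFraming K ν) :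
    pageTwisting g (baseReflection g ∘ K)
        (fun θ => mfderiv (𝓡∂ 4) (𝓡∂ 4) (baseReflection g) (K θ) (ν θ)) =
      -pageTwisting g K ν := by
  set ℓ : ℝ → ℂ := pageTwistingLoop g K ν with hℓ
  set ℓ' : ℝ → ℂ := pageTwistingLoop g (baseReflection g ∘ K)
    (fun θ => mfderiv (𝓡∂ 4) (𝓡∂ 4) (baseReflection g) (K θ) (ν θ)) with hℓ'
  have hK1 : ContMDiff (𝓡 1) (𝓡∂ 4) 1 K := hK.contMDiff.of_le (by simp)
  have hℓc : Continuous ℓ := continuous_pageTwistingLoop hK1 hν.continuous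
  have hℓ'c : Continuous ℓ' :=
    continuous_pageTwistingLoop (contMDiff_baseReflection_comp hK1)
      (continuous_mfderiv_baseReflection_bundle hν.continuous)
  have hℓ0 : ∀ t, ℓ t ≠ 0 := fun t => pageTwistingLoop_ne_zero_of_isKnotFraming hc hK hpage hν t
  have hP := pageTwistingLoop_baseReflection_pointwise (g := g) hc hK hpage hν
  -- the straight-line homotopy from `ℓ'` to `-conj ℓ`
  set H : ℝ → ℝ → ℂ := fun s t => (1 - s : ℝ) * ℓ' t + (s : ℝ) * (-conj (ℓ t)) with hH
  have hHc : ContinuousOn (uncurry H) (Icc 0 1 ×ˢ Icc 0 1) := by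
    refine Continuous.continuousOn ?_
    exact ((Complex.continuous_ofReal.comp (continuous_const.sub continuous_fst)).mul
      (hℓ'c.comp continuous_snd)).add ((Complex.continuous_ofReal.comp continuous_fst).mul
        (Complex.continuous_conj.comp (hℓc.comp continuous_snd)).neg)
  have hHloop : ∀ s ∈ Icc (0 : ℝ) 1, H s 0 = H s 1 := fun s _ => by
    simp only [hH, hℓ, hℓ', pageTwistingLoop_zero_eq_one]
  have hHne : ∀ s ∈ Icc (0 : ℝ) 1, ∀ t ∈ Icc (0 : ℝ) 1, H s t ≠ 0 := by
    intro s _ t _ hz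
    obtain ⟨h1, h2⟩ := hP t
    have him : (ℓ t).im = 0 := by
      have := congrArg Complex.im hz
      simp only [hH, Complex.add_im, Complex.im_ofReal_mul, Complex.neg_im, Complex.conj_im, neg_neg,
        Complex.zero_im] at this
      rw [h1] at this
      linarith
    have hre : (ℓ t).re = 0 := by
      have := congrArg Complex.re hz
      simp only [hH, Complex.add_re, Complex.re_ofReal_mul, Complex.neg_re, Complex.conj_re,
        Complex.zero_re] at this
      rw [h2 him] at this
      linarith
    exact hℓ0 t (Complex.ext hre him)
  have hwind := wind_eq_of_homotopy hHc hHloop hHne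
  have hH0 : H 0 = ℓ' := by funext t; simp [hH]
  have hH1 : H 1 = fun t => -conj (ℓ t) := by funext t; simp [hH]
  rw [hH0, hH1] at hwind
  have hnl : IsNonvanishingLoop ℓ := ⟨hℓc.continuousOn, fun t _ => hℓ0 t, pageTwistingLoop_zero_eq_one⟩
  have hnlc : IsNonvanishingLoop fun t => conj (ℓ t) :=
    ⟨(Complex.continuous_conj.comp hℓc).continuousOn, fun t _ => (map_ne_zero _).2 (hℓ0 t),
      by simp only [hℓ, pageTwistingLoop_zero_eq_one]⟩
  show wind ℓ' = -wind ℓ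
  rw [hwind, wind_neg hnlc, wind_conj hnl]

/-- **Sub-goal `helper_pageTwisting_baseReflection`** (NF6, node "fibred orientation-reversing
involution of the base", consumer form for T3 / ORSEAM, lead c5 wave 2): **transporting a framed
page curve along the fibred reflection `σ = baseReflection g` negates its page twisting.**  For a
smooth embedding `K : 𝕊¹ → Base g` with values in the page `page g c` (`‖c‖ = 1`) and a framing
`ν` of `K` in `∂ Base g` (`IsKnotFraming K ν`),
`pageTwisting g (σ ∘ K) (dσ(ν)) = -pageTwisting g K ν`. [folklore] -/
theorem helper_pageTwisting_baseReflection : ∀ (g : ℕ) (c : ℂ)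
    (K : Metric.sphere (0 : EuclideanSpace ℝ (Fin 2)) 1 →
      Literature.Topology.FourManifolds.LefschetzBase.Base g)
    (ν : Metric.sphere (0 : EuclideanSpace ℝ (Fin 2)) 1 → EuclideanSpace ℝ (Fin 4)),
    ‖c‖ = 1 → Manifold.IsSmoothEmbedding (𝓡 1) (𝓡∂ 4) ∞ K →
    (∀ θ, K θ ∈ Literature.Topology.FourManifolds.LefschetzBase.page g c) →
    Literature.Geometry.Symplectic.IsKnotFraming K ν →
    Literature.Topology.FourManifolds.LefschetzBase.pageTwisting g
        (Summit.SmoothPoincare4.SmoothPoincare4.Theorems.AcyclicBisectionExists.ModpBraidOrbits.baseReflection g ∘ K)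
        (fun θ => mfderiv (𝓡∂ 4) (𝓡∂ 4)
          (Summit.SmoothPoincare4.SmoothPoincare4.Theorems.AcyclicBisectionExists.ModpBraidOrbits.baseReflection g)
          (K θ) (ν θ)) =
      -Literature.Topology.FourManifolds.LefschetzBase.pageTwisting g K ν :=
  fun _ _ _ _ hc hK hpage hν => pageTwisting_baseReflection hc hK hpage hν

end Twisting

/-! ## §8 The shadow action of `σ` -/

open Literature.AlgebraicTopology.SingularHomology in
/-- **The fibred reflection acts on homology shadows through a fixed `ℤ`-linear automorphism of
`ℤ^{2g}`**: there is `S : ℤ^{2g} ≃ₗ[ℤ] ℤ^{2g}` — the matrix of `σ_* : H₁(Base g; ℤ) → H₁(Base g; ℤ)`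
(`singularHomology.mapIso` of the homeomorphism `σ`) in the chain coordinates, `shadowMap g` being a
bijection by Milnor's theorem (`exists_isChainShadow_holds`) — with `shadow g (σ ∘ K) = S (shadow g K)`
for every loop `K : 𝕊¹ → Base g` (naturality of the Hurewicz class, `map_loopClass`). [folklore] -/
theorem exists_shadow_baseReflection_comp (g : ℕ) :
    ∃ S : (Fin g ⊕ Fin g → ℤ) ≃ₗ[ℤ] (Fin g ⊕ Fin g → ℤ),
      ∀ (K : sphere (0 : EuclideanSpace ℝ (Fin 2)) 1 → Base g) (hK : Continuous K),
        shadow g (baseReflection g ∘ K) ((baseReflection g).continuous.comp hK) = S (shadow g K hK) := by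
  have hbij := (isChainShadow_shadowMap g (exists_isChainShadow_holds g)).1
  set e : singularHomology ℤ ℤ (Base g) 1 ≃ₗ[ℤ] (Fin g ⊕ Fin g → ℤ) :=
    LinearEquiv.ofBijective (shadowMap g) hbij with he
  set f : C(Base g, Base g) := ((baseReflection g).toHomeomorph : C(Base g, Base g)) with hf
  set H : singularHomology ℤ ℤ (Base g) 1 ≃ₗ[ℤ] singularHomology ℤ ℤ (Base g) 1 :=
    (singularHomology.mapIso ℤ ℤ (baseReflection g).toHomeomorph 1).toLinearEquiv with hH
  refine ⟨(e.symm.trans H).trans e, fun K hK => ?_⟩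
  have hpath : loopPath (baseReflection g ∘ K) ((baseReflection g).continuous.comp hK) =
      (loopPath K hK).map f.continuous := by
    ext s; rfl
  have he' : ∀ c, e c = shadowMap g c := fun c => rfl
  have key : ∀ c, e.symm (shadowMap g c) = c := fun c => by
    rw [← he' c, LinearEquiv.symm_apply_apply]
  have hmap : H (loopClass ℤ ℤ (1 : ℤ) (loopPath K hK)) =
      loopClass ℤ ℤ (1 : ℤ) ((loopPath K hK).map f.continuous) :=
    map_loopClass ℤ ℤ (1 : ℤ) (loopPath K hK) f
  show shadowMap g (loopClass ℤ ℤ (1 : ℤ) (loopPath (baseReflection g ∘ K) _)) =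
    e (H (e.symm (shadowMap g (loopClass ℤ ℤ (1 : ℤ) (loopPath K hK)))))
  rw [key, he', hpath]
  show shadowMap g (loopClass ℤ ℤ (1 : ℤ) ((loopPath K hK).map f.continuous)) =
    shadowMap g (H (loopClass ℤ ℤ (1 : ℤ) (loopPath K hK)))
  rw [hmap]

/-- **Sub-goal `helper_exists_fibredReflection`** (NF6, node "fibred orientation-reversing
involution of the base" = W3 report §3 option (b) / W7 ORSEAM, lead c5 wave 2; definition-free
package of this file and its two prequels): **the Lefschetz base `Base g` carries a fibred
orientation-reversing involution.**  There is a self-diffeomorphism `σ` of `Base g` preserving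
`w` (hence every page as a set, the binding `{w = 0}` and the page angles), preserving `rho` and
the boundary, with `σ ∘ σ = id`, which is the restriction of a smooth map `F` of `ℝ⁴`
(`F(x, y) = (λ(w) x̄, μ(w) ȳ)`) with `det dF = -1` at every point of the base (orientation
reversing) and `ambient (σ x) (dσ v) = dF (ambient x v)`, and which NEGATES the page twisting of
every framed smoothly embedded page curve: `pageTwisting g (σ ∘ K) (dσ ν) = -pageTwisting g K ν`.
[folklore] -/
theorem helper_exists_fibredReflection : ∀ (g : ℕ),
    ∃ σ : Literature.Topology.FourManifolds.LefschetzBase.Base g ≃ₘ⟮𝓡∂ 4, 𝓡∂ 4⟯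
      Literature.Topology.FourManifolds.LefschetzBase.Base g,
    (∀ q, Literature.Topology.FourManifolds.LefschetzBase.w g (σ q).1 =
      Literature.Topology.FourManifolds.LefschetzBase.w g q.1) ∧
    (∀ q, Literature.Topology.FourManifolds.LefschetzBase.rho g (σ q).1 =
      Literature.Topology.FourManifolds.LefschetzBase.rho g q.1) ∧
    (∀ q, σ (σ q) = q) ∧
    (∀ (c : ℂ) q, σ q ∈ Literature.Topology.FourManifolds.LefschetzBase.page g c ↔
      q ∈ Literature.Topology.FourManifolds.LefschetzBase.page g c) ∧
    (∀ q, σ q ∈ (𝓡∂ 4).boundary (Literature.Topology.FourManifolds.LefschetzBase.Base g) ↔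
      q ∈ (𝓡∂ 4).boundary (Literature.Topology.FourManifolds.LefschetzBase.Base g)) ∧
    (∃ F : EuclideanSpace ℝ (Fin 4) → EuclideanSpace ℝ (Fin 4), ContDiff ℝ ∞ F ∧
      (∀ q, (σ q).1 = F q.1) ∧
      (∀ q : Literature.Topology.FourManifolds.LefschetzBase.Base g, (fderiv ℝ F q.1).det = -1) ∧
      (∀ (x : Literature.Topology.FourManifolds.LefschetzBase.Base g) (v : EuclideanSpace ℝ (Fin 4)),
        Literature.Topology.FourManifolds.LefschetzBase.ambient g (σ x) (mfderiv (𝓡∂ 4) (𝓡∂ 4) σ x v) =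
          fderiv ℝ F x.1 (Literature.Topology.FourManifolds.LefschetzBase.ambient g x v))) ∧
    (∀ (c : ℂ) (K : Metric.sphere (0 : EuclideanSpace ℝ (Fin 2)) 1 →
        Literature.Topology.FourManifolds.LefschetzBase.Base g)
      (ν : Metric.sphere (0 : EuclideanSpace ℝ (Fin 2)) 1 → EuclideanSpace ℝ (Fin 4)),
      ‖c‖ = 1 → Manifold.IsSmoothEmbedding (𝓡 1) (𝓡∂ 4) ∞ K →
      (∀ θ, K θ ∈ Literature.Topology.FourManifolds.LefschetzBase.page g c) →
      Literature.Geometry.Symplectic.IsKnotFraming K ν →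
      Literature.Topology.FourManifolds.LefschetzBase.pageTwisting g (σ ∘ K)
          (fun θ => mfderiv (𝓡∂ 4) (𝓡∂ 4) σ (K θ) (ν θ)) =
        -Literature.Topology.FourManifolds.LefschetzBase.pageTwisting g K ν) :=
  fun g => ⟨baseReflection g, w_baseReflection, rho_baseReflection, baseReflection_baseReflection,
    fun _ q => baseReflection_mem_page_iff q, baseReflection_mem_boundary_iff,
    ⟨baseReflectionAmb g, contDiff_baseReflectionAmb g, fun _ => rfl,
      fun q => det_fderiv_baseReflectionAmb_of_rho_le q.2, ambient_mfderiv_baseReflection⟩,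
    fun _ _ _ hc hK hpage hν => pageTwisting_baseReflection hc hK hpage hν⟩

end Summit.SmoothPoincare4.SmoothPoincare4.Theorems.AcyclicBisectionExists.ModpBraidOrbits

end
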